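import Literature.NumberTheory.Automorphic.MeanSquareRegionVolumeGL2
import Literature.NumberTheory.Automorphic.BorelCompactPartGL
import Literature.NumberTheory.Automorphic.IdeleNormOneSplitting
import Literature.NumberTheory.Automorphic.SiegelConeDyadic
import Literature.NumberTheory.Automorphic.AdelicFundamentalDomain
import HarnessLib

/-!
# A Borel covering box in `GL₂(𝔸_K)`: a measurable `T = K · d(S) · n(U)` meeting every coset
# `y · A_G · ι(B(K))` issued from the cusp in `A_G`-measure `≥ m`, with compact coordinate shadows
(Gelbart, *Automorphic forms on adele groups* (1975), §8 (8.11) and §9.B, Lemma 9.8, (9.44)–(9.46):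
the integral of `J_r + J_s` over `Z_∞⁺ G_ℚ \ G_𝔸` is an integral over the cusp `{H > log ε}` of
`Z_∞⁺ B_ℚ \ G_𝔸`, computed in Iwasawa coordinates `x = n a h_t k` with `(n, a, k)` ranging over
the compact `(N_ℚ \ N_𝔸) × (Z_∞⁺ A_ℚ \ A_𝔸)¹ × K` and `t > log ε`; here for the RIGHT quotients
`G ⧸ A_G Γ` of the tree, read through `x ↦ x⁻¹`, in the order `K · A · N` of
`IwasawaHaarGL2KAN.lintegral_eq_iwasawa_kan`, whose Haar density `Δ(a₁/a₂)` is Gelbart's `e^{-2t}`)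

Topic `NumberTheory/Automorphic`; definitions with bodies (`GL2.borelBox`, `posRealIdeleExp`,
`GL2.centerExp`, `GL2.centerArc`, `GL2.boxUnipotentShadow`) and theorems; no
named fact, no instance visible to importers. Part of the inline (D-0026) decomposition of
`Literature.NumberTheory.Automorphic.jacquetLanglands_transfer_exists` (Gelbart Thm. 10.5 via the
trace formula): with `AutomorphicCosetSumUnfolding` (unfolding of coset sums against a weight
`w`, domination `κ m ∫_X Σ_q h(x̃ q̃) ≤ c ∫_G h w` as soon as the fibre functional
`W(y) = Σ_{γ' ∈ Γ'} ∫_{A_G} w(y z ι(γ')) dz` is `≥ m` on `{h ≠ 0}`) this file supplies, for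
`G = GL₂`, `Γ' = B(K)`, a weight `w = 1_T` adapted to the cusp:

* `GL2.borelBox U S₂ S₁ = {k d(a₁, a₂) n(x) : k ∈ K, x ∈ U, a₂ ∈ S₂, a₁/a₂ ∈ S₁}` (**definition**);
  `GL2.borelBox_eq_image`, `GL2.isCompact_borelBox`, `GL2.measurableSet_borelBox` (compact data,
  σ-compact `S₁`).
* `ideleNorm_borelDiagGL2_eq_one` — the diagonal entries of the compact group `B(𝔸_K) ∩ K`
  (`borelCompactPartGL2`) have idele norm one (a bounded subgroup of `ℝ_{>0}` is trivial,
  `NNReal.eq_one_of_pow_mem_of_bddAbove`); `borelDiagGL2_mul/_inv/_pow`.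
* `exists_eq_cover_mul_principal_mul_posRealIdele` — `x = w · ι(k) · ρ(e^s)` with `w` in the
  compact norm-one cover `W` (`exists_isCompact_normOne_cover`: `𝕀_K¹ = W · ι(Kˣ)`), `k ∈ Kˣ`, and
  `s ≤ 0` when `|x|_𝔸 ≤ 1`.
* `GL2.exists_mul_mem_borelBox` — **covering**: for `y = k d(a₁, a₂) u` with `|a₁/a₂|_𝔸 ≤ 1` there
  are `β = d(q₁, q₂) n(ξ) ∈ B(K)` and `s₀` with `y · z(e^{s-s₀}) · ι(β) ∈ T` for all `s ∈ [0, 1]`,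
  `T = T(C, W·E([0,1]), W·E(ℝ_{≤0}))` (`C ⊇ D`, Tate's additive fundamental domain: `n(ξ)`,
  `ξ ∈ K`, moves the unipotent coordinate `ι(q₁)⁻¹ u₀₁ ι(q₂)` into `D`);
  `GL2.measure_centerArc_le_tsum_lintegral_indicator` — hence
  **`α(arc) ≤ Σ'_{β ∈ B(K)} ∫⁻_{A_G} 1_T(y z ι(β)) dα(z)`** for every left invariant `α` on `A_G`,
  where `arc = {z(e^s) : s ∈ [0, 1]}` has `0 < α(arc) < ∞` (`GL2.measure_centerArc_ne_zero`,
  `GL2.measure_centerArc_lt_top`).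
* `GL2.coords_of_mem_borelBox` — **shadows**: if `k d(a₁, a₂) u ∈ T(U, S₂, W·E)` then `u₀₁` lies in
  the compact `GL2.boxUnipotentShadow U W = {m₀₁ w⁻¹} + U`, `a₂ ∈ M₂ · S₂` and the norm-one part
  `r(a₁/a₂) ∈ R_M · W` (uniqueness of the Borel coordinates `d(a) n(x)`, `borelCoordGL2`, modulo
  `B(𝔸_K) ∩ K`, whose unipotent entries have no archimedean part,
  `GL2.fst_borelUnipGL2_apply_zero_one_eq_zero`).
* `GL2.exists_borelCoveringBox` — **everything packaged**: a measurable `T`, compact `U, D₂` and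
  compact `D₁ ⊆ 𝕀_K¹` with the covering inequality (for all `α`, some `m ∈ (0, ∞)`) and the
  shadow property.

In the `J`-part estimate this reduces `∫_X Σ_{q ∈ Γ/B(K)} χ_ε |F_B|(x̃ q̃) dμ` to
`C ∫_K ∫_{a₂ ∈ D₂} ∫_{r(a₁/a₂) ∈ D₁, |a₁/a₂| < ε⁻²} Δ(a₁/a₂) ∫_{u₀₁ ∈ U} |F_B(k d(a) u)|`, Gelbart's
`c_G ∫_{log ε}^∞ ∫_{ω × K} |Σ …| dv dk e^{-2t} dt` ((9.44)–(9.46)).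

## References

* S. Gelbart, *Automorphic forms on adele groups*, Ann. of Math. Studies 83 (1975), (8.7)–(8.11),
  Lemma 9.8, (9.44)–(9.46) [Gelbart1975].
* J. W. S. Cassels, A. Fröhlich (eds.), *Algebraic Number Theory* (1967), Ch. II §16 (compactness of
  `𝕀_K¹ / Kˣ`), Ch. XV §4.1 (Tate's fundamental domain) [CasselsFrohlichANT1967].
-/

noncomputable section

open MeasureTheory Measure NumberField IsDedekindDomain Matrix Set Filter Topology
open scoped MatrixGroups ENNReal NNReal Pointwise

namespace Literature.NumberTheory.Automorphic

open Literature.NumberTheory.GaloisRepresentations (ideleGroup)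

/-! ### `2 × 2` algebra: `d(a, b)`, `n(x)` under ring maps and their commutation rule -/

section Algebra

variable {R S : Type*} [CommRing R] [CommRing S]

/-- **`d(a, b) n(x) = n(a x b⁻¹) d(a, b)`**: moving the torus through the unipotent radical.
[folklore] -/
theorem diagGL2_mul_unipotentGL2_general (a b : Rˣ) (x : R) :
    diagGL2 a b * ((unipotentGL2 x : ↥(upperUnitriangular (Fin 2) R)) : GL (Fin 2) R) =
      ((unipotentGL2 ((a : R) * x * ((b⁻¹ : Rˣ) : R)) : ↥(upperUnitriangular (Fin 2) R)) :
        GL (Fin 2) R) * diagGL2 a b := by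
  have h := diagGL2_inv_mul_unipotentGL2_mul_diagGL2 a b ((a : R) * x * ((b⁻¹ : Rˣ) : R))
  have hx : ((a⁻¹ : Rˣ) : R) * ((a : R) * x * ((b⁻¹ : Rˣ) : R)) * b = x := by
    have : ((a⁻¹ : Rˣ) : R) * ((a : R) * x * ((b⁻¹ : Rˣ) : R)) * b =
        (((a⁻¹ : Rˣ) : R) * a) * x * (((b⁻¹ : Rˣ) : R) * b) := by ring
    rw [this, Units.inv_mul, Units.inv_mul, one_mul, mul_one]
  rw [hx, mul_assoc, inv_mul_eq_iff_eq_mul] at h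
  exact h.symm

end Algebra

/-! ### Bounded subgroups of `ℝ_{>0}` are trivial -/

/-- If all powers of `x` and of `x⁻¹` lie in a bounded subset of `ℝ≥0` then `x = 1` (`x ≠ 0`).
[folklore] -/
theorem NNReal.eq_one_of_pow_mem_of_bddAbove {S : Set ℝ≥0} (hS : BddAbove S) {x : ℝ≥0}
    (hx : x ≠ 0) (hpow : ∀ n : ℕ, x ^ n ∈ S) (hinv : ∀ n : ℕ, x⁻¹ ^ n ∈ S) : x = 1 := by
  obtain ⟨B, hB⟩ := hS
  have hle : ∀ y : ℝ≥0, (∀ n : ℕ, y ^ n ∈ S) → y ≤ 1 := by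
    intro y hy
    by_contra hlt
    rw [not_le] at hlt
    obtain ⟨k, hk⟩ := pow_unbounded_of_one_lt (B : ℝ) (show (1 : ℝ) < y from by exact_mod_cast hlt)
    have h1 : (y ^ k : ℝ≥0) ≤ B := hB (hy k)
    have h2 : ((y : ℝ) ^ k) ≤ B := by exact_mod_cast h1
    exact absurd (hk.trans_le h2) (lt_irrefl _)
  have h1 := hle x hpow
  have h2 := hle x⁻¹ hinv
  rw [inv_le_one₀ (pos_iff_ne_zero.2 hx)] at h2
  exact le_antisymm h1 h2

/-! ### The compact group `B(𝔸_K) ∩ K`: its diagonal entries have norm one -/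

section CompactBorel

variable {R : Type*} [CommRing R]

/-- The diagonal part is multiplicative (the group law `B = T ⋉ N` in coordinates,
`borelCoordGL2_mul`). [folklore] -/
theorem borelDiagGL2_mul (b b' : ↥(standardParabolicGL R (id : Fin 2 → Fin 2))) :
    borelDiagGL2 (b * b') = borelDiagGL2 b * borelDiagGL2 b' := by
  have hb : b = borelCoordGL2 (borelDiagGL2 b, borelUnipGL2 b) :=
    ((borelCoordGL2 (R := R)).apply_symm_apply b).symm
  have hb' : b' = borelCoordGL2 (borelDiagGL2 b', borelUnipGL2 b') :=
    ((borelCoordGL2 (R := R)).apply_symm_apply b').symm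
  conv_lhs => rw [hb, hb', borelCoordGL2_mul]
  change ((borelCoordGL2 (R := R)).symm (borelCoordGL2 _)).1 = _
  rw [Equiv.symm_apply_apply]

/-- The diagonal part of `1` is `(1, 1)`. [folklore] -/
theorem borelDiagGL2_one : borelDiagGL2 (1 : ↥(standardParabolicGL R (id : Fin 2 → Fin 2))) = 1 := by
  refine Prod.ext (Units.ext ?_) (Units.ext ?_)
  · rw [coe_borelDiagGL2_fst]; simp
  · rw [coe_borelDiagGL2_snd]; simp

/-- The diagonal part of `b⁻¹` is `(borelDiagGL2 b)⁻¹`. [folklore] -/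
theorem borelDiagGL2_inv (b : ↥(standardParabolicGL R (id : Fin 2 → Fin 2))) :
    borelDiagGL2 b⁻¹ = (borelDiagGL2 b)⁻¹ :=
  eq_inv_of_mul_eq_one_left (by rw [← borelDiagGL2_mul, inv_mul_cancel, borelDiagGL2_one])

/-- Powers. [folklore] -/
theorem borelDiagGL2_pow (b : ↥(standardParabolicGL R (id : Fin 2 → Fin 2))) (n : ℕ) :
    borelDiagGL2 (b ^ n) = borelDiagGL2 b ^ n := by
  induction n with
  | zero => rw [pow_zero, pow_zero, borelDiagGL2_one]
  | succ n ih => rw [pow_succ, pow_succ, borelDiagGL2_mul, ih]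

variable (K : Type) [Field K] [NumberField K]

local notation "𝔸K" => AdeleRing (𝓞 K) K
local notation "𝕀K" => (AdeleRing (𝓞 K) K)ˣ

/-- `B ∩ K` is closed under products (it is the trace on `B` of the subgroup `K`). [folklore] -/
theorem mul_mem_borelCompactPartGL2 {b b' : ↥(standardParabolicGL 𝔸K (id : Fin 2 → Fin 2))}
    (hb : b ∈ borelCompactPartGL2 K) (hb' : b' ∈ borelCompactPartGL2 K) :
    b * b' ∈ borelCompactPartGL2 K :=
  (standardMaximalCompactGL 2 K).mul_mem hb hb'

/-- `B ∩ K` is closed under inverses. [folklore] -/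
theorem inv_mem_borelCompactPartGL2 {b : ↥(standardParabolicGL 𝔸K (id : Fin 2 → Fin 2))}
    (hb : b ∈ borelCompactPartGL2 K) : b⁻¹ ∈ borelCompactPartGL2 K :=
  (standardMaximalCompactGL 2 K).inv_mem hb

/-- **The diagonal entries of `B(𝔸_K) ∩ K` have idele norm one**: `κ ↦ |κ₀₀|_𝔸`, `κ ↦ |κ₁₁|_𝔸` are
continuous and multiplicative on the compact group `B ∩ K`, hence bounded together with their
inverses, hence trivial. [folklore] -/
theorem ideleNorm_borelDiagGL2_eq_one {b : ↥(standardParabolicGL 𝔸K (id : Fin 2 → Fin 2))}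
    (hb : b ∈ borelCompactPartGL2 K) :
    IdeleClassGroup.ideleNorm K (borelDiagGL2 b).1 = 1 ∧
      IdeleClassGroup.ideleNorm K (borelDiagGL2 b).2 = 1 := by
  haveI : T2Space 𝔸K := t2Space_adeleRing K
  have hcn : Continuous (IdeleClassGroup.ideleNorm K) := continuous_ideleNorm_holds K
  have hcd : Continuous (borelDiagGL2 (R := 𝔸K)) := continuous_borelDiagGL2
  -- the two bounded sets of norms
  set S₁ : Set ℝ≥0 := (fun c => IdeleClassGroup.ideleNorm K (borelDiagGL2 c).1) ''
    borelCompactPartGL2 K with hS₁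
  set S₂ : Set ℝ≥0 := (fun c => IdeleClassGroup.ideleNorm K (borelDiagGL2 c).2) ''
    borelCompactPartGL2 K with hS₂
  have hS₁b : BddAbove S₁ :=
    ((isCompact_borelCompactPartGL2 K).image (hcn.comp (continuous_fst.comp hcd))).bddAbove
  have hS₂b : BddAbove S₂ :=
    ((isCompact_borelCompactPartGL2 K).image (hcn.comp (continuous_snd.comp hcd))).bddAbove
  have hpow : ∀ n : ℕ, b ^ n ∈ borelCompactPartGL2 K := fun n =>
    (standardMaximalCompactGL 2 K).pow_mem hb n
  have hipow : ∀ n : ℕ, b⁻¹ ^ n ∈ borelCompactPartGL2 K := fun n =>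
    (standardMaximalCompactGL 2 K).pow_mem (inv_mem_borelCompactPartGL2 K hb) n
  constructor
  · refine NNReal.eq_one_of_pow_mem_of_bddAbove hS₁b (ideleNorm_ne_zero _) (fun n => ?_) (fun n => ?_)
    · refine ⟨b ^ n, hpow n, ?_⟩
      change IdeleClassGroup.ideleNorm K (borelDiagGL2 (b ^ n)).1 = _
      rw [borelDiagGL2_pow, Prod.pow_fst, map_pow]
    · refine ⟨b⁻¹ ^ n, hipow n, ?_⟩
      change IdeleClassGroup.ideleNorm K (borelDiagGL2 (b⁻¹ ^ n)).1 = _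
      rw [borelDiagGL2_pow, borelDiagGL2_inv, Prod.pow_fst, Prod.fst_inv, map_pow, map_inv]
  · refine NNReal.eq_one_of_pow_mem_of_bddAbove hS₂b (ideleNorm_ne_zero _) (fun n => ?_) (fun n => ?_)
    · refine ⟨b ^ n, hpow n, ?_⟩
      change IdeleClassGroup.ideleNorm K (borelDiagGL2 (b ^ n)).2 = _
      rw [borelDiagGL2_pow, Prod.pow_snd, map_pow]
    · refine ⟨b⁻¹ ^ n, hipow n, ?_⟩
      change IdeleClassGroup.ideleNorm K (borelDiagGL2 (b⁻¹ ^ n)).2 = _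
      rw [borelDiagGL2_pow, borelDiagGL2_inv, Prod.pow_snd, Prod.snd_inv, map_pow, map_inv]

end CompactBorel


/-! ### The box `T = K · n(U) · d(S)` and its shape -/

section Box

variable (K : Type) [Field K] [NumberField K]

local notation "𝔸K" => AdeleRing (𝓞 K) K
local notation "𝕀K" => (AdeleRing (𝓞 K) K)ˣ

/-- **The Borel box** `T(U, S₂, S₁) = {k d(a₁, a₂) n(x) : k ∈ K, x ∈ U, a₂ ∈ S₂, a₁ a₂⁻¹ ∈ S₁}`
in `GL₂(𝔸_K)` (order `K · A · N`): maximal compact part, second torus coordinate in `S₂`, simple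
root `a₁/a₂` in `S₁` and unipotent coordinate in `U ⊆ 𝔸_K`. For Gelbart's `x = n a h_t k` on
`Z_∞⁺ B_ℚ \ G_𝔸` ((8.11), (9.44)) read through `x ↦ x⁻¹`. [cite: Gelbart1975, (8.11) and (9.44)] -/
def GL2.borelBox (U : Set 𝔸K) (S₂ S₁ : Set 𝕀K) : Set (GL (Fin 2) 𝔸K) :=
  {g | ∃ k ∈ standardMaximalCompactGL 2 K, ∃ x ∈ U, ∃ a₁ a₂ : 𝕀K, a₂ ∈ S₂ ∧ a₁ * a₂⁻¹ ∈ S₁ ∧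
    g = k * diagGL2 a₁ a₂ * ((unipotentGL2 x : ↥(adelicUnipotent 2 K)) : GL (Fin 2) 𝔸K)}

variable {K}

/-- Membership in the box from coordinates. [folklore] -/
theorem GL2.mem_borelBox {U : Set 𝔸K} {S₂ S₁ : Set 𝕀K} {k : GL (Fin 2) 𝔸K}
    (hk : k ∈ standardMaximalCompactGL 2 K) {x : 𝔸K} (hx : x ∈ U) {a₁ a₂ : 𝕀K} (h₂ : a₂ ∈ S₂)
    (h₁ : a₁ * a₂⁻¹ ∈ S₁) :
    k * diagGL2 a₁ a₂ * ((unipotentGL2 x : ↥(adelicUnipotent 2 K)) : GL (Fin 2) 𝔸K) ∈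
      GL2.borelBox K U S₂ S₁ :=
  ⟨k, hk, x, hx, a₁, a₂, h₂, h₁, rfl⟩

/-- The box is monotone in `S₁`. [folklore] -/
theorem GL2.borelBox_mono {U : Set 𝔸K} {S₂ S₁ S₁' : Set 𝕀K} (h : S₁ ⊆ S₁') :
    GL2.borelBox K U S₂ S₁ ⊆ GL2.borelBox K U S₂ S₁' := by
  rintro _ ⟨k, hk, x, hx, a₁, a₂, h₂, h₁, rfl⟩
  exact ⟨k, hk, x, hx, a₁, a₂, h₂, h h₁, rfl⟩

/-- The box as a continuous image of `K × U × S₁ × S₂` (coordinates `(k, x, a₁/a₂, a₂)`). [folklore] -/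
theorem GL2.borelBox_eq_image (U : Set 𝔸K) (S₂ S₁ : Set 𝕀K) :
    GL2.borelBox K U S₂ S₁ = (fun p : GL (Fin 2) 𝔸K × 𝔸K × 𝕀K × 𝕀K =>
      p.1 * diagGL2 (p.2.2.1 * p.2.2.2) p.2.2.2 *
        ((unipotentGL2 p.2.1 : ↥(adelicUnipotent 2 K)) : GL (Fin 2) 𝔸K)) ''
      ((standardMaximalCompactGL 2 K : Set (GL (Fin 2) 𝔸K)) ×ˢ U ×ˢ S₁ ×ˢ S₂) := by
  ext g
  constructor
  · rintro ⟨k, hk, x, hx, a₁, a₂, h₂, h₁, rfl⟩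
    refine ⟨(k, x, a₁ * a₂⁻¹, a₂), ⟨hk, hx, h₁, h₂⟩, ?_⟩
    simp only [inv_mul_cancel_right]
  · rintro ⟨⟨k, x, l, a₂⟩, ⟨hk, hx, h₁, h₂⟩, rfl⟩
    refine ⟨k, hk, x, hx, l * a₂, a₂, h₂, ?_, rfl⟩
    simpa only [mul_inv_cancel_right] using h₁

/-- The coordinate map of the box is continuous. [folklore] -/
theorem GL2.continuous_boxMap :
    Continuous fun p : GL (Fin 2) 𝔸K × 𝔸K × 𝕀K × 𝕀K =>
      p.1 * diagGL2 (p.2.2.1 * p.2.2.2) p.2.2.2 *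
        ((unipotentGL2 p.2.1 : ↥(adelicUnipotent 2 K)) : GL (Fin 2) 𝔸K) := by
  refine (continuous_fst.mul ?_).mul ?_
  · exact (continuous_diagGL2 (R := 𝔸K)).comp
      (((continuous_fst.comp (continuous_snd.comp continuous_snd)).mul
        (continuous_snd.comp (continuous_snd.comp continuous_snd))).prodMk
        (continuous_snd.comp (continuous_snd.comp continuous_snd)))
  · exact continuous_subtype_val.comp
      (continuous_unipotentGL2.comp (continuous_fst.comp continuous_snd))

/-- **Boxes with compact data are compact.** [folklore] -/
theorem GL2.isCompact_borelBox {U : Set 𝔸K} {S₂ S₁ : Set 𝕀K} (hU : IsCompact U)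
    (hS₂ : IsCompact S₂) (hS₁ : IsCompact S₁) : IsCompact (GL2.borelBox K U S₂ S₁) := by
  rw [GL2.borelBox_eq_image]
  exact ((isCompact_standardMaximalCompactGL 2 K).prod (hU.prod (hS₁.prod hS₂))).image
    GL2.continuous_boxMap

/-- The box is additive in `S₁` under unions. [folklore] -/
theorem GL2.borelBox_iUnion {ι : Type*} (U : Set 𝔸K) (S₂ : Set 𝕀K) (S : ι → Set 𝕀K) :
    GL2.borelBox K U S₂ (⋃ i, S i) = ⋃ i, GL2.borelBox K U S₂ (S i) := by
  ext g
  simp only [GL2.borelBox, Set.mem_setOf_eq, Set.mem_iUnion]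
  constructor
  · rintro ⟨k, hk, x, hx, a₁, a₂, h₂, ⟨i, h₁⟩, rfl⟩
    exact ⟨i, k, hk, x, hx, a₁, a₂, h₂, h₁, rfl⟩
  · rintro ⟨i, k, hk, x, hx, a₁, a₂, h₂, h₁, rfl⟩
    exact ⟨k, hk, x, hx, a₁, a₂, h₂, ⟨i, h₁⟩, rfl⟩

/-- **Boxes with compact `U, S₂` and σ-compact `S₁` are measurable.** [folklore] -/
theorem GL2.measurableSet_borelBox [MeasurableSpace (GL (Fin 2) 𝔸K)] [BorelSpace (GL (Fin 2) 𝔸K)]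
    {U : Set 𝔸K} {S₂ : Set 𝕀K} (hU : IsCompact U) (hS₂ : IsCompact S₂) {S : ℕ → Set 𝕀K}
    (hS : ∀ n, IsCompact (S n)) : MeasurableSet (GL2.borelBox K U S₂ (⋃ n, S n)) := by
  haveI : T2Space (GL (Fin 2) 𝔸K) := (topology_gl2_adele K).1
  rw [GL2.borelBox_iUnion]
  exact MeasurableSet.iUnion fun n => (GL2.isCompact_borelBox hU hS₂ (hS n)).measurableSet

/-! ### Positive real ideles with exponent in an interval -/

variable (K)

/-- `E(I) = {ρ(e^s) : s ∈ I} ⊆ 𝔸_Kˣ`, the positive real scalar ideles with exponent in `I ⊆ ℝ`.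
[folklore] -/
def posRealIdeleExp (I : Set ℝ) : Set 𝕀K := (fun s : ℝ => posRealIdele K (expUnitNNReal s)) '' I

/-- `E(I)` is compact for compact `I`. [folklore] -/
theorem isCompact_posRealIdeleExp {I : Set ℝ} (hI : IsCompact I) : IsCompact (posRealIdeleExp K I) :=
  hI.image ((continuous_posRealIdele K).comp continuous_expUnitNNReal)

/-- `E(I) ⊆ ρ(ℝ_{>0})`. [folklore] -/
theorem posRealIdeleExp_subset (I : Set ℝ) : posRealIdeleExp K I ⊆ posRealIdeles K := by
  rintro _ ⟨s, -, rfl⟩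
  exact posRealIdele_mem_posRealIdeles K _

/-- `E(ℝ_{≤ 0}) = ⋃_n E([-n, 0])`. [folklore] -/
theorem posRealIdeleExp_Iic_zero :
    posRealIdeleExp K (Iic 0) = ⋃ n : ℕ, posRealIdeleExp K (Icc (-(n : ℝ)) 0) := by
  have h : (Iic (0 : ℝ)) = ⋃ n : ℕ, Icc (-(n : ℝ)) 0 := by
    ext s
    simp only [mem_Iic, mem_iUnion, mem_Icc]
    constructor
    · intro hs
      obtain ⟨n, hn⟩ := exists_nat_ge (-s)
      exact ⟨n, by linarith, hs⟩
    · rintro ⟨n, -, hs⟩; exact hs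
  rw [posRealIdeleExp, h, image_iUnion]
  rfl

/-- `d(ρ, ρ) = z(ρ)`: the positive real scalar matrix as a diagonal matrix. [folklore] -/
theorem posRealScalar_two_eq_diagGL2 (t : ℝ≥0ˣ) :
    posRealScalar 2 K t = diagGL2 (posRealIdele K t) (posRealIdele K t) := by
  refine Matrix.GeneralLinearGroup.ext fun i j => ?_
  rw [posRealScalar_eq_posRealDiagonal_const, coe_posRealDiagonal, coe_diagGL2]
  fin_cases i <;> fin_cases j <;> simp

end Box

/-! ### Covering: every coset `y · A_G · ι(B(K))` from the cusp meets the box -/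

section Covering

variable (K : Type) [Field K] [NumberField K]

local notation "𝔸K" => AdeleRing (𝓞 K) K
local notation "𝕀K" => (AdeleRing (𝓞 K) K)ˣ

/-- **Splitting an idele as `w · ι(k) · ρ(e^s)`** with `w` in the norm-one cover `W`, `k ∈ Kˣ` and
`s = log |x|^{1/[K:ℚ]}`; if `|x|_𝔸 ≤ 1` then `s ≤ 0`. [cite: CasselsFrohlichANT1967, Ch. II §16 Theorem] -/
theorem exists_eq_cover_mul_principal_mul_posRealIdele {W : Set 𝕀K}
    (hWcov : ∀ x : 𝕀K, IdeleClassGroup.ideleNorm K x = 1 →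
      ∃ k : Kˣ, ∃ w ∈ W, x = w * principalIdele K k) (x : 𝕀K) :
    ∃ w ∈ W, ∃ k : Kˣ, ∃ s : ℝ, x = w * principalIdele K k * posRealIdele K (expUnitNNReal s) ∧
      (IdeleClassGroup.ideleNorm K x ≤ 1 → s ≤ 0) := by
  obtain ⟨t, ht⟩ := normOneRetraction_inv_mul_mem K x
  obtain ⟨k, w, hw, hxw⟩ := hWcov (normOneRetraction K x) (ideleNorm_normOneRetraction K x)
  refine ⟨w, hw, k, Real.log ((t : ℝ≥0) : ℝ), ?_, fun hle => ?_⟩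
  · rw [expUnitNNReal_log, ht, ← hxw, mul_inv_cancel_left]
  · have hnorm : IdeleClassGroup.ideleNorm K x = (t : ℝ≥0) ^ Module.finrank ℚ K := by
      have h1 : x = normOneRetraction K x * posRealIdele K t := by
        rw [ht, mul_inv_cancel_left]
      rw [h1, map_mul, ideleNorm_normOneRetraction, one_mul, ideleNorm_posRealIdele_holds K t]
    rw [hnorm, pow_le_one_iff_of_nonneg (by positivity) Module.finrank_pos.ne'] at hle
    exact Real.log_nonpos (NNReal.coe_nonneg _) (by exact_mod_cast hle)

/-- **Covering.** For the norm-one cover `W` (`𝕀_K¹ = W · ι(Kˣ)`) and `C ⊇ D` (Tate's additive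
fundamental domain), every `y = k d(a₁, a₂) u` with `|a₁/a₂|_𝔸 ≤ 1` has a rational Borel element
`β = d(q₁, q₂) n(ξ) ∈ B(K)` and an exponent `s₀` such that
`y · z(e^{s - s₀}) · ι(β) ∈ T(C, W·E([0,1]), W·E(ℝ_{≤0}))` for all `s ∈ [0, 1]`
(`a₂` is moved into `W·E([0,1])` by `ι(q₂)` and the scalar, the root `a₁/a₂` into `W·E(≤0)` by
`ι(q₁)`, and the unipotent coordinate `ι(q₁)⁻¹ u₀₁ ι(q₂)` into `D` by `n(ξ)`, `ξ ∈ K`). This is the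
statement that `K × ((A_ℚ Z_∞⁺)\\A_𝔸 ∩ {H ≥ 0}) × (N_ℚ\\N_𝔸)` parametrises the cusp of
`Z_∞⁺ B_ℚ \\ G_𝔸` (Gelbart (1975), (8.11), (9.44)). [cite: Gelbart1975, (8.11) and (9.44)] -/
theorem GL2.exists_mul_mem_borelBox {W : Set 𝕀K}
    (hWcov : ∀ x : 𝕀K, IdeleClassGroup.ideleNorm K x = 1 →
      ∃ k : Kˣ, ∃ w ∈ W, x = w * principalIdele K k)
    {C : Set 𝔸K} (hC : adeleFundamentalDomain K ⊆ C)
    {k : GL (Fin 2) 𝔸K} (hk : k ∈ standardMaximalCompactGL 2 K) (a₁ a₂ : 𝕀K)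
    (u : ↥(adelicUnipotent 2 K)) (hle : IdeleClassGroup.ideleNorm K (a₁ * a₂⁻¹) ≤ 1) :
    ∃ β ∈ standardParabolicGL K (id : Fin 2 → Fin 2), ∃ s₀ : ℝ, ∀ s ∈ Icc (0 : ℝ) 1,
      k * diagGL2 a₁ a₂ * (u : GL (Fin 2) 𝔸K) * posRealScalar 2 K (expUnitNNReal (s - s₀)) *
          Matrix.GeneralLinearGroup.map (algebraMap K 𝔸K) β ∈
        GL2.borelBox K C (W * posRealIdeleExp K (Icc 0 1)) (W * posRealIdeleExp K (Iic 0)) := by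
  -- split `a₂ = w₂ ι(k₂) ρ(e^{s₂})`
  obtain ⟨w₂, hw₂, k₂, s₂, ha₂, -⟩ := exists_eq_cover_mul_principal_mul_posRealIdele K hWcov a₂
  -- split `λ₀ = a₁ a₂⁻¹ ι(k₂) = w₁ ι(k₁) ρ(e^{s₁})`, `s₁ ≤ 0`
  obtain ⟨w₁, hw₁, k₁, s₁, hl, hs₁⟩ :=
    exists_eq_cover_mul_principal_mul_posRealIdele K hWcov (a₁ * a₂⁻¹ * principalIdele K k₂)
  have hs₁' : s₁ ≤ 0 := by
    refine hs₁ ?_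
    rw [map_mul, ideleNorm_principal ⟨k₂, rfl⟩, mul_one]
    exact hle
  -- the new torus coordinates for the scalar `ρ(e^{s - s₂})`
  set a₁' : ℝ → 𝕀K := fun s => a₁ * posRealIdele K (expUnitNNReal (s - s₂)) * principalIdele K k₁⁻¹
    with ha₁'
  set a₂' : ℝ → 𝕀K := fun s => a₂ * posRealIdele K (expUnitNNReal (s - s₂)) * principalIdele K k₂⁻¹
    with ha₂'
  have ha₂'eq : ∀ s, a₂' s = w₂ * posRealIdele K (expUnitNNReal s) := by
    intro s
    simp only [ha₂']
    rw [ha₂, map_inv, mul_inv_eq_iff_eq_mul]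
    have : s = s₂ + (s - s₂) := by ring
    conv_rhs => rw [this]
    rw [expUnitNNReal_add, map_mul]
    ac_rfl
  have hlameq : ∀ s, a₁' s * (a₂' s)⁻¹ = w₁ * posRealIdele K (expUnitNNReal s₁) := by
    intro s
    have e1 : a₁' s = a₁ * (principalIdele K k₁)⁻¹ * posRealIdele K (expUnitNNReal (s - s₂)) := by
      simp only [ha₁', map_inv]; ac_rfl
    have e2 : a₂' s = a₂ * (principalIdele K k₂)⁻¹ * posRealIdele K (expUnitNNReal (s - s₂)) := by
      simp only [ha₂', map_inv]; ac_rfl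
    have h1 : a₁' s * (a₂' s)⁻¹ = a₁ * a₂⁻¹ * principalIdele K k₂ * (principalIdele K k₁)⁻¹ := by
      rw [e1, e2, _root_.mul_inv_rev, ← mul_assoc, mul_assoc (a₁ * _) (posRealIdele K _),
        mul_inv_cancel, mul_one, _root_.mul_inv_rev, inv_inv]
      ac_rfl
    rw [h1, hl, mul_inv_eq_iff_eq_mul]
    ac_rfl
  -- the rational torus element `d(ι(k₁)⁻¹, ι(k₂)⁻¹)` and the conjugated unipotent
  set c₁ : 𝕀K := Units.map (algebraMap K 𝔸K : K →* 𝔸K) k₁⁻¹ with hc₁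
  set c₂ : 𝕀K := Units.map (algebraMap K 𝔸K : K →* 𝔸K) k₂⁻¹ with hc₂
  set τ : ↥(adelicUnipotent 2 K) := torusConjGL2 (c₁, c₂) u with hτ
  -- the unipotent coordinate: choose `ξ ∈ K` with `ι(ξ) + τ₀₁ ∈ D`
  obtain ⟨ξ, hξ, -⟩ := existsUnique_add_algebraMap_mem_adeleFundamentalDomain K
    ((((τ : ↥(adelicUnipotent 2 K)) : GL (Fin 2) 𝔸K) : Matrix (Fin 2) (Fin 2) 𝔸K) 0 1)
  refine ⟨diagGL2 k₁⁻¹ k₂⁻¹ * ((unipotentGL2 ξ : ↥(upperUnitriangular (Fin 2) K)) : GL (Fin 2) K),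
    mul_mem (diagGL2_mem_standardParabolicGL _ _)
      (upperUnitriangular_le_standardParabolicGL_fin_two (unipotentGL2 ξ).2), s₂, fun s hs => ?_⟩
  -- rewrite the product in the form `k · d(a₁', a₂') · n(x')`
  have hcomm : (u : GL (Fin 2) 𝔸K) * posRealScalar 2 K (expUnitNNReal (s - s₂)) =
      posRealScalar 2 K (expUnitNNReal (s - s₂)) * (u : GL (Fin 2) 𝔸K) :=
    Subgroup.mem_center_iff.1 (posRealScalar_mem_center 2 K _) _
  have hconj : (u : GL (Fin 2) 𝔸K) * diagGL2 c₁ c₂ =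
      diagGL2 c₁ c₂ * ((τ : ↥(adelicUnipotent 2 K)) : GL (Fin 2) 𝔸K) :=
    (diagGL2_mul_torusConjGL2 (c₁, c₂) u).symm
  have hunip : ((τ : ↥(adelicUnipotent 2 K)) : GL (Fin 2) 𝔸K) *
      ((unipotentGL2 (algebraMap K 𝔸K ξ) : ↥(upperUnitriangular (Fin 2) 𝔸K)) : GL (Fin 2) 𝔸K) =
      ((unipotentGL2 (algebraMap K 𝔸K ξ +
        (((τ : ↥(adelicUnipotent 2 K)) : GL (Fin 2) 𝔸K) : Matrix (Fin 2) (Fin 2) 𝔸K) 0 1) :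
          ↥(upperUnitriangular (Fin 2) 𝔸K)) : GL (Fin 2) 𝔸K) := by
    rw [← Subgroup.coe_mul, add_comm, unipotentGL2_add, unipotentGL2_entry]
  have hd : diagGL2 a₁ a₂ * posRealScalar 2 K (expUnitNNReal (s - s₂)) * diagGL2 c₁ c₂ =
      diagGL2 (a₁' s) (a₂' s) := by
    rw [posRealScalar_two_eq_diagGL2, ← diagGL2_mul, ← diagGL2_mul]
  have hprod : k * diagGL2 a₁ a₂ * (u : GL (Fin 2) 𝔸K) * posRealScalar 2 K (expUnitNNReal (s - s₂)) *
      Matrix.GeneralLinearGroup.map (algebraMap K 𝔸K)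
        (diagGL2 k₁⁻¹ k₂⁻¹ * ((unipotentGL2 ξ : ↥(upperUnitriangular (Fin 2) K)) : GL (Fin 2) K)) =
      k * diagGL2 (a₁' s) (a₂' s) * ((unipotentGL2 (algebraMap K 𝔸K ξ +
        (((τ : ↥(adelicUnipotent 2 K)) : GL (Fin 2) 𝔸K) : Matrix (Fin 2) (Fin 2) 𝔸K) 0 1) :
          ↥(adelicUnipotent 2 K)) : GL (Fin 2) 𝔸K) := by
    rw [map_mul, map_diagGL2, map_unipotentGL2, ← hd, ← hunip]
    change k * diagGL2 a₁ a₂ * (u : GL (Fin 2) 𝔸K) * posRealScalar 2 K (expUnitNNReal (s - s₂)) *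
        (diagGL2 c₁ c₂ * ((unipotentGL2 (algebraMap K 𝔸K ξ) : ↥(upperUnitriangular (Fin 2) 𝔸K)) :
          GL (Fin 2) 𝔸K)) = _
    rw [mul_assoc (k * diagGL2 a₁ a₂) (u : GL (Fin 2) 𝔸K), hcomm]
    simp only [mul_assoc]
    rw [← mul_assoc (u : GL (Fin 2) 𝔸K) (diagGL2 c₁ c₂), hconj, mul_assoc]
  rw [hprod]
  refine GL2.mem_borelBox hk ?_ ?_ ?_
  · exact hC hξ
  · rw [ha₂'eq]
    exact Set.mul_mem_mul hw₂ ⟨s, hs, rfl⟩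
  · rw [hlameq]
    exact Set.mul_mem_mul hw₁ ⟨s₁, hs₁', rfl⟩

end Covering


/-! ### The `A_G`-measure of the covering -/

section CenterMeasure

variable (K : Type) [Field K] [NumberField K]

local notation "𝔸K" => AdeleRing (𝓞 K) K
local notation "𝕀K" => (AdeleRing (𝓞 K) K)ˣ
local notation "G₂" => AdelicGroupData.gl 2 K

/-- `z(e^s) ∈ A_G` as an element of the split centre `A_G = (AdelicGroupData.gl 2 K).center'`.
[folklore] -/
def GL2.centerExp (s : ℝ) : ↥(G₂).center' :=
  ⟨posRealScalar 2 K (expUnitNNReal s), ⟨expUnitNNReal s, rfl⟩⟩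

/-- Underlying matrix of `centerExp s`. [folklore] -/
@[simp]
theorem GL2.coe_centerExp (s : ℝ) :
    ((GL2.centerExp K s : ↥(G₂).center') : (G₂).Adelic) = posRealScalar 2 K (expUnitNNReal s) := rfl

/-- `s ↦ z(e^s)` is a one-parameter group. [folklore] -/
theorem GL2.centerExp_add (s t : ℝ) :
    GL2.centerExp K (s + t) = GL2.centerExp K s * GL2.centerExp K t := by
  refine Subtype.ext ?_
  change posRealScalar 2 K (expUnitNNReal (s + t)) =
    posRealScalar 2 K (expUnitNNReal s) * posRealScalar 2 K (expUnitNNReal t)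
  rw [expUnitNNReal_add, map_mul]

/-- `s ↦ z(e^s)` is continuous. [folklore] -/
theorem GL2.continuous_centerExp : Continuous (GL2.centerExp K) := by
  have h : Continuous fun s : ℝ => posRealScalar 2 K (expUnitNNReal s) := by
    have h1 := (continuous_posRealDiagonal_expUnitNNReal 2 K).comp
      (continuous_pi fun (_ : Fin 2) => (continuous_id (X := ℝ)))
    refine h1.congr fun s => ?_
    exact (posRealScalar_eq_posRealDiagonal_const 2 K (expUnitNNReal s)).symm
  exact h.subtype_mk _

/-- `s ↦ z(e^s)` is onto `A_G`. [folklore] -/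
theorem GL2.exists_centerExp_eq (z : ↥(G₂).center') : ∃ s : ℝ, GL2.centerExp K s = z := by
  obtain ⟨t, ht⟩ := z.2
  refine ⟨Real.log ((t : ℝ≥0) : ℝ), Subtype.ext ?_⟩
  change posRealScalar 2 K (expUnitNNReal (Real.log ((t : ℝ≥0) : ℝ))) = (z : (G₂).Adelic)
  rw [expUnitNNReal_log, ht]

/-- The **unit arc** `{z(e^s) : s ∈ [0, 1]} ⊆ A_G`, a compact set of positive finite Haar measure
whose `A_G`-translates cover `A_G`; its measure is the constant `m` of the covering inequality.
[folklore] -/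
def GL2.centerArc : Set ↥(G₂).center' := GL2.centerExp K '' Icc 0 1

/-- The unit arc is compact. [folklore] -/
theorem GL2.isCompact_centerArc : IsCompact (GL2.centerArc K) :=
  isCompact_Icc.image (GL2.continuous_centerExp K)

/-- The unit arc has finite measure for every measure on `A_G` finite on compacta. [folklore] -/
theorem GL2.measure_centerArc_lt_top {mA : MeasurableSpace (G₂).Adelic}
    (α : Measure ↥(G₂).center') [IsFiniteMeasureOnCompacts α] :
    α (GL2.centerArc K) < ∞ :=
  (GL2.isCompact_centerArc K).measure_lt_top

set_option synthInstance.maxHeartbeats 400000 in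
/-- **The unit arc has positive measure** for every non-zero left invariant measure on `A_G`: its
translates `z(e^n) · arc`, `n ∈ ℤ`, cover `A_G`. [folklore] -/
theorem GL2.measure_centerArc_ne_zero {mA : MeasurableSpace (G₂).Adelic} [BorelSpace (G₂).Adelic]
    (α : Measure ↥(G₂).center') [α.IsMulLeftInvariant] (hα : α ≠ 0) :
    α (GL2.centerArc K) ≠ 0 := by
  haveI : BorelSpace ↥(G₂).center' := Subtype.borelSpace _
  haveI : MeasurableMul ↥(G₂).center' := by infer_instance
  haveI : SMulInvariantMeasure ↥(G₂).center' ↥(G₂).center' α := by infer_instance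
  intro h0
  have hcov : (Set.univ : Set ↥(G₂).center') ⊆ ⋃ n : ℤ, (GL2.centerExp K n) • GL2.centerArc K := by
    intro z _
    obtain ⟨s, rfl⟩ := GL2.exists_centerExp_eq K z
    refine Set.mem_iUnion.2 ⟨⌊s⌋, ?_⟩
    refine Set.mem_smul_set.2 ⟨GL2.centerExp K (s - ⌊s⌋), ⟨s - ⌊s⌋,
      ⟨by linarith [Int.floor_le s], by linarith [Int.lt_floor_add_one s]⟩, rfl⟩, ?_⟩
    change GL2.centerExp K (⌊s⌋ : ℝ) * GL2.centerExp K (s - ⌊s⌋) = GL2.centerExp K s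
    rw [← GL2.centerExp_add]
    congr 1
    ring
  have hle : α Set.univ ≤ ∑' n : ℤ, α ((GL2.centerExp K n) • GL2.centerArc K) :=
    (measure_mono hcov).trans (measure_iUnion_le _)
  simp only [measure_smul, h0, tsum_zero, nonpos_iff_eq_zero, Measure.measure_univ_eq_zero] at hle
  exact hα hle

set_option synthInstance.maxHeartbeats 400000 in
/-- **The covering inequality in `A_G`-measure.** With `W`, `C` as in `GL2.exists_mul_mem_borelBox`
and `T = T(C, W·E([0,1]), W·E(ℝ_{≤0}))`: for every left invariant measure `α` on `A_G` and every
`y = k d(a₁, a₂) u` with `|a₁/a₂|_𝔸 ≤ 1`,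

  `α(arc) ≤ Σ'_{β ∈ B(K)} ∫⁻_{A_G} 1_T(y z ι(β)) dα(z)`

(the term of the good `β` alone is `≥ α(z(e^{-s₀}) · arc) = α(arc)`). This is the hypothesis `hW` of
`AdelicGroupData.mul_lintegral_tsum_quotient_le` (`AutomorphicCosetSumUnfolding`) for `w = 1_T`,
`Γ' = B(K)`, on the cusp (the argument of `1_T` is written in `G(𝔸_K) = (AdelicGroupData.gl 2 K).Adelic`
as there). [cite: Gelbart1975, (8.11) and (9.44)] -/
theorem GL2.measure_centerArc_le_tsum_lintegral_indicator {W : Set 𝕀K}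
    (hWcov : ∀ x : 𝕀K, IdeleClassGroup.ideleNorm K x = 1 →
      ∃ k : Kˣ, ∃ w ∈ W, x = w * principalIdele K k)
    {C : Set 𝔸K} (hC : adeleFundamentalDomain K ⊆ C)
    {mA : MeasurableSpace (G₂).Adelic} [BorelSpace (G₂).Adelic]
    (α : Measure ↥(G₂).center') [α.IsMulLeftInvariant]
    {k : GL (Fin 2) 𝔸K} (hk : k ∈ standardMaximalCompactGL 2 K) (a₁ a₂ : 𝕀K)
    (u : ↥(adelicUnipotent 2 K)) (hle : IdeleClassGroup.ideleNorm K (a₁ * a₂⁻¹) ≤ 1) :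
    α (GL2.centerArc K) ≤ ∑' β : ↥(standardParabolicGL K (id : Fin 2 → Fin 2)),
      ∫⁻ z : ↥(G₂).center', (GL2.borelBox K C (W * posRealIdeleExp K (Icc 0 1))
          (W * posRealIdeleExp K (Iic 0))).indicator 1
        (@id (G₂).Adelic (k * diagGL2 a₁ a₂ * (u : GL (Fin 2) 𝔸K)) * (z : (G₂).Adelic) *
          (G₂).toAdelic (β : GL (Fin 2) K)) ∂α := by
  haveI : T2Space (G₂).Adelic := (topology_gl2_adele K).1
  haveI : BorelSpace ↥(G₂).center' := Subtype.borelSpace _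
  haveI : MeasurableMul ↥(G₂).center' := by infer_instance
  haveI : SMulInvariantMeasure ↥(G₂).center' ↥(G₂).center' α := by infer_instance
  obtain ⟨β, hβ, s₀, hmem⟩ := GL2.exists_mul_mem_borelBox K hWcov hC hk a₁ a₂ u hle
  refine le_trans ?_ (ENNReal.le_tsum ⟨β, hβ⟩)
  set T := GL2.borelBox K C (W * posRealIdeleExp K (Icc 0 1)) (W * posRealIdeleExp K (Iic 0)) with hT
  have hmeas : MeasurableSet ((GL2.centerExp K (-s₀)) • GL2.centerArc K) :=
    ((GL2.isCompact_centerArc K).smul _).measurableSet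
  have key : ∀ z : ↥(G₂).center',
      ((GL2.centerExp K (-s₀)) • GL2.centerArc K).indicator (1 : ↥(G₂).center' → ℝ≥0∞) z ≤
      T.indicator (1 : (G₂).Adelic → ℝ≥0∞) (@id (G₂).Adelic (k * diagGL2 a₁ a₂ * (u : GL (Fin 2) 𝔸K)) *
        (z : (G₂).Adelic) * (G₂).toAdelic (β : GL (Fin 2) K)) := by
    intro z
    by_cases hz : z ∈ (GL2.centerExp K (-s₀)) • GL2.centerArc K
    · obtain ⟨x, ⟨s, hs, rfl⟩, rfl⟩ := Set.mem_smul_set.1 hz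
      rw [Set.indicator_of_mem hz, Set.indicator_of_mem]
      · exact le_rfl
      · have hcoe : (((GL2.centerExp K (-s₀) • GL2.centerExp K s : ↥(G₂).center') : (G₂).Adelic) :
            GL (Fin 2) 𝔸K) = posRealScalar 2 K (expUnitNNReal (s - s₀)) := by
          change posRealScalar 2 K (expUnitNNReal (-s₀)) * posRealScalar 2 K (expUnitNNReal s) = _
          rw [← map_mul, ← expUnitNNReal_add]
          congr 2
          ring
        have h := hmem s hs
        rw [← hcoe] at h
        exact h
    · rw [Set.indicator_of_notMem hz]
      exact bot_le
  calc α (GL2.centerArc K) = α ((GL2.centerExp K (-s₀)) • GL2.centerArc K) := (measure_smul _ _ _).symm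
    _ = ∫⁻ z, ((GL2.centerExp K (-s₀)) • GL2.centerArc K).indicator 1 z ∂α :=
        (lintegral_indicator_one hmeas).symm
    _ ≤ _ := lintegral_mono key

end CenterMeasure

/-! ### Saturation: coordinates of the points of the box -/

section Saturation

variable (K : Type) [Field K] [NumberField K]

local notation "𝔸K" => AdeleRing (𝓞 K) K
local notation "𝕀K" => (AdeleRing (𝓞 K) K)ˣ

/-- The compact **unipotent shadow** of a box: `{m₀₁ w⁻¹ : m ∈ M_N, w ∈ W} + U`, where `M_N` is the
set of unipotent coordinates of `B(𝔸_K) ∩ K`. [folklore] -/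
def GL2.boxUnipotentShadow (U : Set 𝔸K) (W : Set 𝕀K) : Set 𝔸K :=
  (fun p : ↥(adelicUnipotent 2 K) × 𝕀K =>
      (((p.1 : GL (Fin 2) 𝔸K) : Matrix (Fin 2) (Fin 2) 𝔸K) 0 1) * ((p.2⁻¹ : 𝕀K) : 𝔸K)) ''
    ((borelUnipGL2 '' borelCompactPartGL2 K) ×ˢ W) + U

/-- The unipotent shadow of a box with compact `U`, `W` is compact. [folklore] -/
theorem GL2.isCompact_boxUnipotentShadow {U : Set 𝔸K} {W : Set 𝕀K} (hU : IsCompact U)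
    (hW : IsCompact W) : IsCompact (GL2.boxUnipotentShadow K U W) := by
  haveI : T2Space 𝔸K := t2Space_adeleRing K
  have hMN : IsCompact (borelUnipGL2 '' borelCompactPartGL2 K) :=
    (isCompact_borelCompactPartGL2 K).image continuous_borelUnipGL2
  refine IsCompact.add ((hMN.prod hW).image ?_) hU
  refine Continuous.mul ?_ (Units.continuous_val.comp (continuous_inv.comp continuous_snd))
  exact ((Units.continuous_val.matrix_elem 0 1).comp continuous_subtype_val).comp continuous_fst

/-- The `(0,1)` entry of the unipotent part `d(t)⁻¹ κ` of `κ ∈ B(𝔸_K) ∩ K` has vanishing archimedean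
component (`κ₀₁` does, `fst_apply_eq_zero_of_mem_standardMaximalCompactGL`). [folklore] -/
theorem GL2.fst_borelUnipGL2_apply_zero_one_eq_zero
    {c : ↥(standardParabolicGL 𝔸K (id : Fin 2 → Fin 2))} (hc : c ∈ borelCompactPartGL2 K) :
    ((((borelUnipGL2 c : ↥(adelicUnipotent 2 K)) : GL (Fin 2) 𝔸K) : Matrix (Fin 2) (Fin 2) 𝔸K) 0 1).1
      = 0 := by
  have hB : ((c : GL (Fin 2) 𝔸K) : Matrix (Fin 2) (Fin 2) 𝔸K).BlockTriangular id := by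
    intro i j hij
    fin_cases i <;> fin_cases j <;> simp at hij
    exact mem_standardParabolicGL_fin_two_iff.1 c.2
  have h01 : (((c : GL (Fin 2) 𝔸K) : Matrix (Fin 2) (Fin 2) 𝔸K) 0 1).1 = 0 :=
    fst_apply_eq_zero_of_mem_standardMaximalCompactGL hc hB (by decide)
  have hentry : (((borelUnipGL2 c : ↥(adelicUnipotent 2 K)) : GL (Fin 2) 𝔸K) :
      Matrix (Fin 2) (Fin 2) 𝔸K) 0 1 = (((borelDiagGL2 c).1⁻¹ : 𝕀K) : 𝔸K) *
        ((c : GL (Fin 2) 𝔸K) : Matrix (Fin 2) (Fin 2) 𝔸K) 0 1 := by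
    change ((((diagGL2 (borelDiagGL2 c).1 (borelDiagGL2 c).2)⁻¹ * (c : GL (Fin 2) 𝔸K) :
      GL (Fin 2) 𝔸K) : Matrix (Fin 2) (Fin 2) 𝔸K) 0 1) = _
    rw [diagGL2_inv, Units.val_mul, coe_diagGL2, Matrix.mul_apply, Fin.sum_univ_two]
    simp
  have hmul : ∀ p q : 𝔸K, (p * q).1 = p.1 * q.1 := fun _ _ => rfl
  rw [hentry, hmul, h01, mul_zero]

/-- `m · e = m` for an adele `m` with vanishing archimedean component and a positive real idele `e`.
[folklore] -/
theorem mul_coe_eq_self_of_fst_eq_zero {m : 𝔸K} (hm : m.1 = 0) {e : 𝕀K} (he : e ∈ posRealIdeles K) :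
    m * (e : 𝔸K) = m := by
  obtain ⟨t, rfl⟩ := he
  refine Prod.ext ?_ ?_
  · change m.1 * ((posRealIdele K t : 𝕀K) : 𝔸K).1 = m.1
    rw [hm, zero_mul]
  · change m.2 * ((posRealIdele K t : 𝕀K) : 𝔸K).2 = m.2
    rw [posRealIdele_snd, mul_one]

/-- **Coordinates of the points of a box** (uniqueness of the coordinates `d(a) n(x)` modulo the
compact group `B(𝔸_K) ∩ K`, whose diagonal entries have norm one and whose unipotent entries have
no archimedean component): if `k d(a₁, a₂) u ∈ T(U, S₂, W·E)` with `k ∈ K`, `W ⊆ 𝕀_K¹` and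
`E ⊆ ρ(ℝ_{>0})`, then `u₀₁` lies in the unipotent shadow `{m₀₁ w⁻¹} + U`, `a₂` in `M₂ · S₂` and the
norm-one part `r(a₁/a₂)` in `R_M · W`, where `M₂ = {t₂}`, `R_M = {t₁/t₂}` over the diagonal parts
`(t₁, t₂)` of `B(𝔸_K) ∩ K` (compact sets). [folklore] -/
theorem GL2.coords_of_mem_borelBox {W : Set 𝕀K} (hW1 : ∀ w ∈ W, IdeleClassGroup.ideleNorm K w = 1)
    {E : Set 𝕀K} (hE : E ⊆ posRealIdeles K) {U : Set 𝔸K} {S₂ : Set 𝕀K}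
    {k : GL (Fin 2) 𝔸K} (hk : k ∈ standardMaximalCompactGL 2 K) {a₁ a₂ : 𝕀K}
    {u : ↥(adelicUnipotent 2 K)}
    (h : k * diagGL2 a₁ a₂ * (u : GL (Fin 2) 𝔸K) ∈ GL2.borelBox K U S₂ (W * E)) :
    ((u : GL (Fin 2) 𝔸K) : Matrix (Fin 2) (Fin 2) 𝔸K) 0 1 ∈ GL2.boxUnipotentShadow K U W ∧
      a₂ ∈ (Prod.snd '' (borelDiagGL2 '' borelCompactPartGL2 K)) * S₂ ∧
      normOneRetraction K (a₁ * a₂⁻¹) ∈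
        ((fun t : 𝕀K × 𝕀K => t.1 * t.2⁻¹) '' (borelDiagGL2 '' borelCompactPartGL2 K)) * W := by
  obtain ⟨k', hk', x', hx', a₁', a₂', h₂, h₁, hEq⟩ := h
  obtain ⟨w, hw, e, he, hwe⟩ := Set.mem_mul.1 h₁
  -- `c = k⁻¹ k' ∈ B ∩ K`
  set c : GL (Fin 2) 𝔸K := k⁻¹ * k' with hc
  have hcK : c ∈ standardMaximalCompactGL 2 K := mul_mem (inv_mem hk) hk'
  have hceq : diagGL2 a₁ a₂ * (u : GL (Fin 2) 𝔸K) =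
      c * (diagGL2 a₁' a₂' * (((unipotentGL2 x' : ↥(adelicUnipotent 2 K)) : GL (Fin 2) 𝔸K))) := by
    rw [hc, mul_assoc k⁻¹, ← mul_assoc k', ← hEq, ← mul_assoc, ← mul_assoc, inv_mul_cancel, one_mul]
  have hcB : c ∈ standardParabolicGL 𝔸K (id : Fin 2 → Fin 2) := by
    have : c = diagGL2 a₁ a₂ * (u : GL (Fin 2) 𝔸K) *
        (diagGL2 a₁' a₂' * (((unipotentGL2 x' : ↥(adelicUnipotent 2 K)) : GL (Fin 2) 𝔸K)))⁻¹ := by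
      rw [hceq, mul_inv_cancel_right]
    rw [this]
    exact mul_mem (mul_mem (diagGL2_mem_standardParabolicGL _ _)
      (upperUnitriangular_le_standardParabolicGL_fin_two u.2)) (inv_mem (mul_mem
        (diagGL2_mem_standardParabolicGL _ _)
        (upperUnitriangular_le_standardParabolicGL_fin_two (unipotentGL2 x').2)))
  set cB : ↥(standardParabolicGL 𝔸K (id : Fin 2 → Fin 2)) := ⟨c, hcB⟩ with hcB'
  have hcM : cB ∈ borelCompactPartGL2 K := hcK
  -- Borel coordinates of `c`
  set t := borelDiagGL2 cB with ht
  set m := borelUnipGL2 cB with hm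
  have hcm : c = diagGL2 t.1 t.2 * ((m : ↥(adelicUnipotent 2 K)) : GL (Fin 2) 𝔸K) :=
    (diagGL2_mul_borelUnipGL2 cB).symm
  -- `c d(a') n(x') = d(t a') (d(a')⁻¹ m d(a')) n(x')`
  have hprod : c * (diagGL2 a₁' a₂' * (((unipotentGL2 x' : ↥(adelicUnipotent 2 K)) : GL (Fin 2) 𝔸K))) =
      diagGL2 (t.1 * a₁') (t.2 * a₂') * ((torusConjGL2 (a₁', a₂') m * unipotentGL2 x' :
        ↥(adelicUnipotent 2 K)) : GL (Fin 2) 𝔸K) := by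
    rw [hcm, diagGL2_mul, Subgroup.coe_mul]
    have h2 := diagGL2_mul_torusConjGL2 (a₁', a₂') m
    simp only at h2
    simp only [mul_assoc]
    rw [← mul_assoc (m : GL (Fin 2) 𝔸K) (diagGL2 a₁' a₂'), ← h2, mul_assoc]
  rw [hprod] at hceq
  have hcoord : (borelCoordGL2 ((a₁, a₂), u) : ↥(standardParabolicGL 𝔸K (id : Fin 2 → Fin 2))) =
      borelCoordGL2 ((t.1 * a₁', t.2 * a₂'), torusConjGL2 (a₁', a₂') m * unipotentGL2 x') :=
    Subtype.ext hceq
  have hinj := borelCoordGL2.injective hcoord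
  simp only [Prod.mk.injEq] at hinj
  obtain ⟨⟨ha₁, ha₂⟩, hu⟩ := hinj
  have htM : t ∈ borelDiagGL2 '' borelCompactPartGL2 K := ⟨cB, hcM, rfl⟩
  refine ⟨?_, ?_, ?_⟩
  · -- `u₀₁ = a₁'⁻¹ m₀₁ a₂' + x' = m₀₁ w⁻¹ + x'`
    have hentry : ((u : GL (Fin 2) 𝔸K) : Matrix (Fin 2) (Fin 2) 𝔸K) 0 1 =
        ((((m : ↥(adelicUnipotent 2 K)) : GL (Fin 2) 𝔸K) : Matrix (Fin 2) (Fin 2) 𝔸K) 0 1) *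
          (((a₁' * a₂'⁻¹)⁻¹ : 𝕀K) : 𝔸K) + x' := by
      rw [hu, ← unipotentGL2_entry (torusConjGL2 (a₁', a₂') m), torusConjGL2_apply_zero_one,
        ← unipotentGL2_add, unipotentGL2_apply_zero_one, _root_.mul_inv_rev, inv_inv, Units.val_mul]
      ring
    have hm0 : ((((m : ↥(adelicUnipotent 2 K)) : GL (Fin 2) 𝔸K) : Matrix (Fin 2) (Fin 2) 𝔸K) 0 1).1 = 0 :=
      GL2.fst_borelUnipGL2_apply_zero_one_eq_zero K hcM
    have hwe' : ((a₁' * a₂'⁻¹)⁻¹ : 𝕀K) = e⁻¹ * w⁻¹ := by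
      rw [← hwe, _root_.mul_inv_rev]
    have hval : ((((m : ↥(adelicUnipotent 2 K)) : GL (Fin 2) 𝔸K) : Matrix (Fin 2) (Fin 2) 𝔸K) 0 1) *
        (((a₁' * a₂'⁻¹)⁻¹ : 𝕀K) : 𝔸K) =
        ((((m : ↥(adelicUnipotent 2 K)) : GL (Fin 2) 𝔸K) : Matrix (Fin 2) (Fin 2) 𝔸K) 0 1) *
          ((w⁻¹ : 𝕀K) : 𝔸K) := by
      rw [hwe', Units.val_mul, ← mul_assoc, mul_coe_eq_self_of_fst_eq_zero K hm0 (inv_mem (hE he))]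
    rw [hentry, hval]
    exact Set.add_mem_add ⟨(m, w), ⟨⟨cB, hcM, rfl⟩, hw⟩, rfl⟩ hx'
  · rw [ha₂]
    exact Set.mul_mem_mul ⟨t, htM, rfl⟩ h₂
  · -- `r(a₁/a₂) = (t₁/t₂) · r(w e) = (t₁/t₂) · w`
    obtain ⟨hn1, hn2⟩ := ideleNorm_borelDiagGL2_eq_one K hcM
    have hq : a₁ * a₂⁻¹ = (t.1 * t.2⁻¹) * (a₁' * a₂'⁻¹) := by
      rw [ha₁, ha₂, _root_.mul_inv_rev]
      ac_rfl
    have hr1 : normOneRetraction K (t.1 * t.2⁻¹) = t.1 * t.2⁻¹ := by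
      refine normOneRetraction_eq_self K ?_
      rw [map_mul, map_inv, show IdeleClassGroup.ideleNorm K t.1 = 1 from hn1,
        show IdeleClassGroup.ideleNorm K t.2 = 1 from hn2, inv_one, mul_one]
    have hr2 : normOneRetraction K (a₁' * a₂'⁻¹) = w := by
      rw [← hwe, map_mul, normOneRetraction_eq_self K (hW1 w hw),
        normOneRetraction_eq_one_of_mem K (hE he), mul_one]
    rw [hq, map_mul, hr1, hr2]
    exact Set.mul_mem_mul ⟨t, htM, rfl⟩ hw

end Saturation

/-! ### The covering box theorem -/

section Main

variable (K : Type) [Field K] [NumberField K]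

local notation "𝔸K" => AdeleRing (𝓞 K) K
local notation "𝕀K" => (AdeleRing (𝓞 K) K)ˣ
local notation "G₂" => AdelicGroupData.gl 2 K

/-- **A Borel covering box for the cusp of `GL₂(𝔸_K)`** (the geometric input of Gelbart's estimate
of `∫ (J_r + J_s)` over the cusp, (9.44)–(9.46), in the right-quotient conventions of the tree).
There are a measurable `T ⊆ GL₂(𝔸_K)`, a compact `U ⊆ 𝔸_K` and compact `D₂ ⊆ 𝔸_Kˣ`,
`D₁ ⊆ 𝕀_K¹` such that:

* (covering, in `A_G`-measure) for every non-zero left invariant measure `α` on the split centre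
  `A_G` finite on compacta there is `m ∈ (0, ∞)` with
  `m ≤ Σ'_{β ∈ B(K)} ∫⁻_{A_G} 1_T(y z ι(β)) dα(z)` for all `y = k d(a₁, a₂) u` (`k ∈ K`, `u ∈ N(𝔸_K)`)
  with `|a₁/a₂|_𝔸 ≤ 1` — the hypothesis `hW` of the domination theorem
  `AdelicGroupData.mul_lintegral_tsum_quotient_le` for the weight `w = 1_T` and `Γ' = B(K)` on the
  region `{|a₁/a₂| ≤ 1}` (which contains every cusp `{|a₁/a₂| < ε⁻²}`, `ε ≥ 1`);
* (shadows) if `k d(a₁, a₂) u ∈ T` with `k ∈ K` then `u₀₁ ∈ U`, `a₂ ∈ D₂` and `r(a₁/a₂) ∈ D₁`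
  (`r` the norm-one retraction): in the Iwasawa coordinates `K · A · N` of
  `IwasawaHaarGL2KAN.lintegral_eq_iwasawa_kan` (Haar measure `c Δ(a₁/a₂) dk da du`, `Δ` the
  module — Gelbart's `e^{-2t}`), `∫_G h 1_T` is an integral over `k ∈ K`, `u₀₁` in a compact set,
  `a₂` in a compact set and `a₁/a₂` in (compact) × `ρ(ℝ_{>0})` against `Δ(a₁/a₂)` — Gelbart's
  `∫_{log ε}^∞ ∫_{ω × K} Σ … dv dk e^{-2t} dt` over the cusp ((9.44), (8.11)).

`T = K · d(S) · n(C)` with `S = {a₂ ∈ W·E([0,1]), a₁/a₂ ∈ W·E(ℝ_{≤0})}`, `W` the compact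
norm-one cover (`exists_isCompact_normOne_cover`), `C ⊇ D` compact (Tate's fundamental domain).
[cite: Gelbart1975, (8.11), Lemma 9.8 and (9.44)–(9.46)] -/
theorem GL2.exists_borelCoveringBox {mA : MeasurableSpace (G₂).Adelic} [BorelSpace (G₂).Adelic] :
    ∃ (T : Set (GL (Fin 2) 𝔸K)) (U : Set 𝔸K) (D₂ D₁ : Set 𝕀K),
      MeasurableSet[mA] T ∧ IsCompact U ∧ IsCompact D₂ ∧ IsCompact D₁ ∧
      (∀ d ∈ D₁, IdeleClassGroup.ideleNorm K d = 1) ∧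
      (∀ (α : Measure ↥(G₂).center') [α.IsMulLeftInvariant] [IsFiniteMeasureOnCompacts α], α ≠ 0 →
        ∃ m : ℝ≥0∞, m ≠ 0 ∧ m ≠ ∞ ∧
          ∀ k ∈ standardMaximalCompactGL 2 K, ∀ (a₁ a₂ : 𝕀K) (u : ↥(adelicUnipotent 2 K)),
            IdeleClassGroup.ideleNorm K (a₁ * a₂⁻¹) ≤ 1 →
            m ≤ ∑' β : ↥(standardParabolicGL K (id : Fin 2 → Fin 2)), ∫⁻ z : ↥(G₂).center',
              T.indicator 1 (@id (G₂).Adelic (k * diagGL2 a₁ a₂ * (u : GL (Fin 2) 𝔸K)) *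
                (z : (G₂).Adelic) * (G₂).toAdelic (β : GL (Fin 2) K)) ∂α) ∧
      (∀ k ∈ standardMaximalCompactGL 2 K, ∀ (a₁ a₂ : 𝕀K) (u : ↥(adelicUnipotent 2 K)),
        k * diagGL2 a₁ a₂ * (u : GL (Fin 2) 𝔸K) ∈ T →
          ((u : GL (Fin 2) 𝔸K) : Matrix (Fin 2) (Fin 2) 𝔸K) 0 1 ∈ U ∧ a₂ ∈ D₂ ∧
            normOneRetraction K (a₁ * a₂⁻¹) ∈ D₁) := by
  haveI : T2Space 𝔸K := t2Space_adeleRing K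
  obtain ⟨W, hWc, hW1, hWcov, -⟩ := exists_isCompact_normOne_cover K
  obtain ⟨C, hCc, -, hDC⟩ := exists_isCompact_adeleFundamentalDomain_subset K
  set M : Set (𝕀K × 𝕀K) := borelDiagGL2 '' borelCompactPartGL2 K with hM
  have hMc : IsCompact M := (isCompact_borelCompactPartGL2 K).image continuous_borelDiagGL2
  have hEc : IsCompact (posRealIdeleExp K (Icc 0 1)) := isCompact_posRealIdeleExp K isCompact_Icc
  refine ⟨GL2.borelBox K C (W * posRealIdeleExp K (Icc 0 1)) (W * posRealIdeleExp K (Iic 0)),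
    GL2.boxUnipotentShadow K C W, (Prod.snd '' M) * (W * posRealIdeleExp K (Icc 0 1)),
    ((fun t : 𝕀K × 𝕀K => t.1 * t.2⁻¹) '' M) * W, ?_, ?_, ?_, ?_, ?_, ?_, ?_⟩
  · -- measurability: `S₁ = ⋃_n W · E([-n, 0])`
    rw [posRealIdeleExp_Iic_zero, Set.mul_iUnion]
    exact @GL2.measurableSet_borelBox K _ _ mA ‹BorelSpace (G₂).Adelic› _ _ hCc (hWc.mul hEc) _
      fun n => hWc.mul (isCompact_posRealIdeleExp K isCompact_Icc)
  · exact GL2.isCompact_boxUnipotentShadow K hCc hWc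
  · exact (hMc.image continuous_snd).mul (hWc.mul hEc)
  · exact (hMc.image (by fun_prop : Continuous fun t : 𝕀K × 𝕀K => t.1 * t.2⁻¹)).mul hWc
  · -- `D₁ ⊆ 𝕀_K¹`
    rintro _ ⟨r, ⟨t, ⟨b, hb, rfl⟩, rfl⟩, w, hw, rfl⟩
    obtain ⟨h1, h2⟩ := ideleNorm_borelDiagGL2_eq_one K hb
    rw [map_mul, map_mul, map_inv, h1, h2, hW1 w hw, inv_one, mul_one, mul_one]
  · intro α _ _ hα
    refine ⟨α (GL2.centerArc K), GL2.measure_centerArc_ne_zero K α hα,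
      (GL2.measure_centerArc_lt_top K α).ne, fun k hk a₁ a₂ u hle => ?_⟩
    exact GL2.measure_centerArc_le_tsum_lintegral_indicator K hWcov hDC α hk a₁ a₂ u hle
  · intro k hk a₁ a₂ u h
    exact GL2.coords_of_mem_borelBox K hW1 (posRealIdeleExp_subset K (Iic 0)) hk h

end Main

end Literature.NumberTheory.Automorphic
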